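import Summits.QuantumFields.BalabanUV.Beta.D1BFx.SplitInstanceS
import Summits.QuantumFields.BalabanUV.Beta.D1BFx.LocalGroupRow

/-!
# `BalabanUV.Beta.D1BFx.LocalGroupRowS` — road «BF-x» for binder row D1, slot (K), «L-WIRE-S»: THE LOCAL GROUP HYPOTHESIS `hLoc` FOR THE TWO-PROFILE RE-CUT
# TABLE `restKS (gfrz n a b) (s n • gfrz n a b)` (variant «ENDₛ», END-ii-SPEC v1.1 §3 (b)∕(c)) — every GLUON local word is the record's (it does not involve
# `ω_gh`; supplied by `LocalGroupRow.hLoc_of_prop12'` read at ghost weight `0`, where its ghost input is vacuous), the three local GHOST bubble words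
# («L-GBUB») are displayed AT THE SECOND PROFILE — the shape gan24-leaf-05-g44's `GhostBubbleTailsII.hGbub_s_of_prop12` supplies under reading (ii)

HONEST DEPENDENCY (cell records, verbatim): «continuum YM on T⁴ ⇐ BetaPertH ∧ nine spine estimates (0/9 proved); BetaPertH ⇐ (D1) ∧ (D4) ∧
CAP+tail; G-an2-4 gates asym, D1 and NE2/3/4.»  HONEST FRAMING (cell contract, verbatim): «discharging `BetaPertH` makes Bałaban's UV stability
UNCONDITIONAL — a real constructive-QFT result; it is NOT the continuum limit and NOT the Clay problem.»  THIS MODULE DISCHARGES NOTHING of the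
wall: [folklore] bookkeeping BY NAME — the owner's `LocalGroupRow.hLoc_of_prop12'` (gen 11; leaf-03-g12 ∕ leaf-04-g10 ∕ leaf-05-g12 cells inside) instantiated at
the ghost weight `0 : ℕ → ℝ` (its «L-GBUB» input is then the zero row), the rfl unfoldings `SplitInstanceS.restKS_*` ∕ `SplitRecut.restK'_*` (a gluon word of the
two-profile table IS the record's gluon word at ANY ghost weight — `ω_gh` does not occur in it), and the fibre membership lemmas.  No `def`, no `def … : Prop`,
nothing cited, 0 sorry.  What stays displayed: everything `hLoc_of_prop12'` displays (the two PRINTED statements `h12`∕`h126` BY NAME, `hlam`, `hJ`, the slot-E and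
slot-R SOCKETS) and the three local ghost bubble rows `hGbub` AT THE PROFILE `s n • gfrz n a b`.  0 wall binders (root-level hW ∕ hR-sockets ∕ hSX-socket ∕ D1Tel ∕
D1Rep — 0); (K) NOT closed; NOT D1, NOT `BetaPertH`, NOT continuum, NOT Clay.

ABSOLUTE RULE (cell charter, verbatim): «No internally-minted statement may enter as a cited fact. Every hypothesis is either kernel-proved in
this package or a verbatim quotation of a PUBLISHED theorem with page reference. The manuscript(s) under audit are NOT citable for their own
disputed steps — they are the thing under adjudication; programme-internal (2001/route/tribunal) claims are never citable.»

WHY (owner ruling ρ-g11-9; `END-ii-SPEC.md` v1.1 §3: «the ONLY profile-dependent ghost rows are L-GBUB-ii (3 words)»).  The local fibre of the label of record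
(`RoadEndBFxRows.localFibre`) holds gluon tadpoles (slots 0, 1, 3), the `00rr′` gluon bubbles, the re-cut cross word, and the ghost bubbles `00rr′` — of which
`0000` is the zero word and the other three are «L-GBUB».  In the two-profile table the gluon words are read at `gfrz` (= the record's, rfl) and the ghost words at
`s n • gfrz` (= `restK'` at that profile, rfl).  So the record's local row theorem transfers word by word, EXCEPT for «L-GBUB», which is displayed in the second
profile — exactly the row `GhostBubbleTailsII.hGbub_s_of_prop12` proves under the rescaled tie with `s n = n⁻²` (4∕4 parts landed, p287155 ∕ p287724 ∕ p288135 ∕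
p288541).  The device «read the record at ghost weight `0`» is bookkeeping only: the record's theorem holds for EVERY ghost weight sequence, its gluon conclusions
do not mention the ghost weight, and at weight `0` its ghost hypothesis is the zero row.

CONTENT.
* §1 [folklore] `restKS_tad_eq_zeroWeight` ∕ `restKS_bub_eq_zeroWeight` ∕ `restKS_crossE_eq_zeroWeight` (gluon words of the two-profile table = the record's words at
  ghost weight `0`, as functions of `w`); `row_gbub_zeroWeight_le` (the record's ghost bubble rows vanish at ghost weight `0`); `row_restKS_gbub_zero_le` (the
  two-profile `0000` ghost word has row `≤ 0`).
* §2 [folklore] **`hLoc_of_prop12'S`** — `∃ CL, ∀ n ≥ 2, ∀ τ ∈ localFibre, |Σ_{b} n⁻⁴·fullSum (w ↦ restKS n a (gfrz n a b) (s n • gfrz n a b) … τ w)| ≤ CL τ` from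
  `hLoc_of_prop12'`'s displayed data and `hGbub` at the second profile.
Unit `b2b-balaban-beta-d1-p2` (gen 12), road «BF-x» OWNER; `LEAVES-BFx.md` row «L-WIRE-S»; END-ii-SPEC v1.1 §3 (b)∕(c).
-/

noncomputable section

open Finset Filter Topology
open scoped BigOperators
open Literature.MathematicalPhysics.QuantumFieldTheory.Balaban1983to89
open Literature.MathematicalPhysics.QuantumFieldTheory.Balaban1983to89.Beta
open ExpKernelCalculus (Site MKer BiLoc Zl)
open DyadicShell (Pt toReal supNorm)
open WindowIdentification (fullSum)
open DressedMomentNormalisation (resSite)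
open VectorTailsLoc (fam kfam)
open Summit.QuantumFields.BalabanUV.Beta.D1BFx.FrozenLegTails (nOf MOf hn1)
open Summit.QuantumFields.BalabanUV.Beta.D1BFx.ReducedKernel (TableR)
open Summit.QuantumFields.BalabanUV.Beta.D1BFx.FineHessianSectors (slotWt slotTab)
open Summit.QuantumFields.BalabanUV.Beta.D1BFx.FrozenLegProfile (gfrz)
open Summit.QuantumFields.BalabanUV.Beta.D1BFx.SplitInstance (RestIdx)
open Summit.QuantumFields.BalabanUV.Beta.D1BFx.SplitRecut (restK' restK'_tad restK'_bub restK'_gbub restK'_crossE)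
open Summit.QuantumFields.BalabanUV.Beta.D1BFx.SplitInstanceS (restKS restKS_tad restKS_bub restKS_gbub restKS_crossE restKS_gbub_eq)
open Summit.QuantumFields.BalabanUV.Beta.D1BFx.RoadEndBFxRecut (cornerIdx)
open Summit.QuantumFields.BalabanUV.Beta.D1BFx.Assembly (fullSum_zero')
open Summit.QuantumFields.BalabanUV.Beta.D1BFx.LamGroupPointwise (lamFibre mem_lamFibre_tad mem_lamFibre_bub)
open Summit.QuantumFields.BalabanUV.Beta.D1BFx.NeedleGroupPointwise (needleFibre' mem_needleFibre'_tad mem_needleFibre'_bub mem_needleFibre'_gbub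
  mem_needleFibre'_gtad)
open Summit.QuantumFields.BalabanUV.Beta.D1BFx.RoadEndBFxRows (localFibre mem_localFibre)
open Summit.QuantumFields.BalabanUV.Beta.D1BFx.LocalGroupRow (hLoc_of_prop12' fin3_eq_zero fin2_eq_zero)

namespace Summit.QuantumFields.BalabanUV.Beta.D1BFx.LocalGroupRowS

variable {a N : ℝ} {μ ν : Fin 4} {cE cΛ cR cK cQ cE₂ cJ4 cΛ₂ cR₂ cQ₂ x₀ ωgl ωgh s : ℕ → ℝ} {WE WJ WΛ WR WQ : ℕ → TableR}

/-! ## §1 The gluon local words of the two-profile table are the record's at ANY ghost weight; the zero rows -/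

section Words

variable (n : ℕ) [NeZero n] (b : Pt)

/-- [folklore] A gluon TADPOLE word of the two-profile table is the record's word read at ghost weight `0` (neither involves `ω_gh`; rfl unfoldings). -/
theorem restKS_tad_eq_zeroWeight (x : Fin 5 × Fin 3) :
    (fun w : Pt => restKS n a (gfrz n a b) (fun v => s n * gfrz n a b v) (cE n) (cΛ n) (cR n) (cK n) (cQ n) (cE₂ n) (cJ4 n) (cΛ₂ n) (cR₂ n) (cQ₂ n) (x₀ n)
        (WE n) (WJ n) (WΛ n) (WR n) (WQ n) (ωgl n) (ωgh n) ((n : ℝ) ^ 8) N μ ν b (Sum.inl x) w)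
      = fun w : Pt => restK' n a (gfrz n a b) (cE n) (cΛ n) (cR n) (cK n) (cQ n) (cE₂ n) (cJ4 n) (cΛ₂ n) (cR₂ n) (cQ₂ n) (x₀ n)
        (WE n) (WJ n) (WΛ n) (WR n) (WQ n) (ωgl n) ((0 : ℕ → ℝ) n) ((n : ℝ) ^ 8) N μ ν b (Sum.inl x) w := by
  funext w
  rw [restKS_tad, restK'_tad]

/-- [folklore] A re-cut gluon BUBBLE word of the two-profile table is the record's word read at ghost weight `0`. -/
theorem restKS_bub_eq_zeroWeight (x : Fin 3 × Fin 3 × Fin 3 × Fin 3) :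
    (fun w : Pt => restKS n a (gfrz n a b) (fun v => s n * gfrz n a b v) (cE n) (cΛ n) (cR n) (cK n) (cQ n) (cE₂ n) (cJ4 n) (cΛ₂ n) (cR₂ n) (cQ₂ n) (x₀ n)
        (WE n) (WJ n) (WΛ n) (WR n) (WQ n) (ωgl n) (ωgh n) ((n : ℝ) ^ 8) N μ ν b (Sum.inr (Sum.inl x)) w)
      = fun w : Pt => restK' n a (gfrz n a b) (cE n) (cΛ n) (cR n) (cK n) (cQ n) (cE₂ n) (cJ4 n) (cΛ₂ n) (cR₂ n) (cQ₂ n) (x₀ n)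
        (WE n) (WJ n) (WΛ n) (WR n) (WQ n) (ωgl n) ((0 : ℕ → ℝ) n) ((n : ℝ) ^ 8) N μ ν b (Sum.inr (Sum.inl x)) w := by
  funext w
  rw [restKS_bub, restK'_bub]

/-- [folklore] The re-cut CROSS word of the two-profile table is the record's word read at ghost weight `0`. -/
theorem restKS_crossE_eq_zeroWeight :
    (fun w : Pt => restKS n a (gfrz n a b) (fun v => s n * gfrz n a b v) (cE n) (cΛ n) (cR n) (cK n) (cQ n) (cE₂ n) (cJ4 n) (cΛ₂ n) (cR₂ n) (cQ₂ n) (x₀ n)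
        (WE n) (WJ n) (WΛ n) (WR n) (WQ n) (ωgl n) (ωgh n) ((n : ℝ) ^ 8) N μ ν b (Sum.inr (Sum.inr (Sum.inr (Sum.inr 1)))) w)
      = fun w : Pt => restK' n a (gfrz n a b) (cE n) (cΛ n) (cR n) (cK n) (cQ n) (cE₂ n) (cJ4 n) (cΛ₂ n) (cR₂ n) (cQ₂ n) (x₀ n)
        (WE n) (WJ n) (WΛ n) (WR n) (WQ n) (ωgl n) ((0 : ℕ → ℝ) n) ((n : ℝ) ^ 8) N μ ν b (Sum.inr (Sum.inr (Sum.inr (Sum.inr 1)))) w := by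
  funext w
  rw [restKS_crossE, restK'_crossE]

end Words

/-- [folklore] **AT GHOST WEIGHT `0` THE RECORD's GHOST BUBBLE ROWS VANISH** — the «L-GBUB» input of `LocalGroupRow.hLoc_of_prop12'` is the zero row there. -/
theorem row_gbub_zeroWeight_le (x : Fin 2 × Fin 2 × Fin 2 × Fin 2) : ∀ n : ℕ, 2 ≤ n → ∀ [NeZero n],
    |∑ b ∈ (univ : Finset (Fin 4 → Fin n)).image resSite, ((n : ℝ) ^ 4)⁻¹ *
      fullSum (fun w : Pt => restK' n a (gfrz n a b) (cE n) (cΛ n) (cR n) (cK n) (cQ n) (cE₂ n) (cJ4 n) (cΛ₂ n) (cR₂ n) (cQ₂ n) (x₀ n)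
        (WE n) (WJ n) (WΛ n) (WR n) (WQ n) (ωgl n) ((0 : ℕ → ℝ) n) ((n : ℝ) ^ 8) N μ ν b (Sum.inr (Sum.inr (Sum.inr (Sum.inl x)))) w)| ≤ 0 := by
  intro n _ _
  have h0 : ∀ b : Pt, (fun w : Pt => restK' n a (gfrz n a b) (cE n) (cΛ n) (cR n) (cK n) (cQ n) (cE₂ n) (cJ4 n) (cΛ₂ n) (cR₂ n) (cQ₂ n) (x₀ n)
      (WE n) (WJ n) (WΛ n) (WR n) (WQ n) (ωgl n) ((0 : ℕ → ℝ) n) ((n : ℝ) ^ 8) N μ ν b (Sum.inr (Sum.inr (Sum.inr (Sum.inl x)))) w) = fun _ => (0 : ℝ) := by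
    intro b; funext w; rw [restK'_gbub]; simp
  simp_rw [h0, fullSum_zero', mul_zero, sum_const_zero, abs_zero, le_refl]

/-- [folklore] The `0000` ghost bubble word of the two-profile table is the zero word (its row is bounded by `0`). -/
theorem row_restKS_gbub_zero_le : ∀ n : ℕ, 2 ≤ n → ∀ [NeZero n],
    |∑ b ∈ (univ : Finset (Fin 4 → Fin n)).image resSite, ((n : ℝ) ^ 4)⁻¹ *
      fullSum (fun w : Pt => restKS n a (gfrz n a b) (fun v => s n * gfrz n a b v) (cE n) (cΛ n) (cR n) (cK n) (cQ n) (cE₂ n) (cJ4 n) (cΛ₂ n) (cR₂ n)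
        (cQ₂ n) (x₀ n) (WE n) (WJ n) (WΛ n) (WR n) (WQ n) (ωgl n) (ωgh n) ((n : ℝ) ^ 8) N μ ν b
          (Sum.inr (Sum.inr (Sum.inr (Sum.inl (((0 : Fin 2), (0 : Fin 2), (0 : Fin 2), (0 : Fin 2))))))) w)| ≤ 0 := by
  intro n _ _
  have h0 : ∀ b : Pt, (fun w : Pt => restKS n a (gfrz n a b) (fun v => s n * gfrz n a b v) (cE n) (cΛ n) (cR n) (cK n) (cQ n) (cE₂ n) (cJ4 n) (cΛ₂ n)
      (cR₂ n) (cQ₂ n) (x₀ n) (WE n) (WJ n) (WΛ n) (WR n) (WQ n) (ωgl n) (ωgh n) ((n : ℝ) ^ 8) N μ ν b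
        (Sum.inr (Sum.inr (Sum.inr (Sum.inl (((0 : Fin 2), (0 : Fin 2), (0 : Fin 2), (0 : Fin 2))))))) w) = fun _ => (0 : ℝ) := by
    intro b; funext w; rw [restKS_gbub]; simp
  simp_rw [h0, fullSum_zero', mul_zero, sum_const_zero, abs_zero, le_refl]

/-! ## §2 The LOCAL group hypothesis for the two-profile table -/

/-- [folklore] **«L-WIRE-S»: THE LOCAL GROUP HYPOTHESIS `hLoc` OF `RoadEndBFxRowsS.hGrp_of_rowsS` FOR THE TWO-PROFILE TABLE** `restKS (gfrz n a b) (s n • gfrz n a b)`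
(ANY scalar family `s`).  Displayed, VERBATIM as in `LocalGroupRow.hLoc_of_prop12'`: [B5, Prop. 1.2] ∧ [B5, (1.126)–(1.127)] BY NAME (`h12`∕`h126`), the pins `hlam`
(`ωgl·cE² = 2N²n⁸`) and `hJ` (`cJ4 = 0`), the END's slot-E sockets (`hδ₀`∕`hδE`∕`hWE`∕`hsuppE`∕`hkE`) and slot R's sockets (`hθR`∕`hδR`∕`hδ₀R`∕`hδRge`∕`hCwR`∕`hWR`∕`hkR`);
and the three local ghost bubble rows `hGbub` — NOW AT THE SECOND PROFILE `fun v => s n * gfrz n a b v` («L-GBUB» of the two-profile table; under reading (ii),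
`s n = n⁻²`, this is gan24-leaf-05-g44's `GhostBubbleTailsII.hGbub_s_of_prop12`).  Conclusion: `∃ CL : RestIdx → ℝ, ∀ n ≥ 2, ∀ τ ∈ localFibre,
|Σ_{b ∈ image resSite} n⁻⁴·fullSum (w ↦ restKS n a (gfrz n a b) (s n • gfrz n a b) … μ ν b τ w)| ≤ CL τ`.  Every gluon local word is supplied by the record's
theorem read at ghost weight `0` (§1); NOTHING is estimated here. -/
theorem hLoc_of_prop12'S (ha : 0 < a) (h12 : B5.Prop12Printed (fam nOf hn1 MOf a ha)) (h126 : B5.Kernel126_127Printed (kfam nOf MOf))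
    (hlam : ∀ n : ℕ, 2 ≤ n → ωgl n * cE n ^ 2 = 2 * N ^ 2 * (n : ℝ) ^ 8) (hJ : ∀ n : ℕ, cJ4 n = 0)
    -- the END's slot-E sockets
    {ρE : ℕ} {CwE δE : ℕ → ℝ} {δ₀ kE : ℝ} (hδ₀ : 0 < δ₀) (hδE : ∀ n, δ₀ ≤ δE n)
    (hWE : ∀ n κ u l u', BiLoc (slotTab (WE n) (WJ n) (WΛ n) (WR n) (WQ n) 0 κ u l u') u u' (CwE n) (δE n))
    (hsuppE : ∀ n κ u l u', ρE < supNorm (u - u') → slotTab (WE n) (WJ n) (WΛ n) (WR n) (WQ n) 0 κ u l u' = 0)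
    (hkE : ∀ n : ℕ, 2 ≤ n → |ωgl n * slotWt (cE₂ n) (cJ4 n) (cΛ₂ n) (cR₂ n) (cQ₂ n) 0| * CwE n ≤ kE * (n : ℝ) ^ 8)
    -- slot R's sockets (the (A2) readout of `WR`)
    {CwR δR : ℕ → ℝ} {θR δ₀R kR : ℝ} (hθR : 0 < θR) (hδR : ∀ n, 0 < δR n) (hδ₀R : 0 < δ₀R) (hδRge : ∀ n : ℕ, δ₀R / n ≤ δR n) (hCwR : ∀ n, 0 ≤ CwR n)
    (hWR : ∀ n κ u l u', BiLoc (slotTab (WE n) (WJ n) (WΛ n) (WR n) (WQ n) 3 κ u l u') u u' (CwR n * Real.exp (-(θR / n) * supNorm (u - u'))) (δR n))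
    (hkR : ∀ n : ℕ, 2 ≤ n → |ωgl n * slotWt (cE₂ n) (cJ4 n) (cΛ₂ n) (cR₂ n) (cQ₂ n) 3| * CwR n * (n : ℝ) ^ 6 ≤ kR)
    -- «L-GBUB» AT THE SECOND PROFILE: the three local ghost bubble words, displayed
    {CG : Fin 2 → Fin 2 → ℝ}
    (hGbub : ∀ (r r' : Fin 2), ¬(r = 0 ∧ r' = 0) → ∀ n : ℕ, 2 ≤ n → ∀ [NeZero n],
      |∑ b ∈ (univ : Finset (Fin 4 → Fin n)).image resSite, ((n : ℝ) ^ 4)⁻¹ *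
        fullSum (fun w : Pt => restK' n a (fun v => s n * gfrz n a b v) (cE n) (cΛ n) (cR n) (cK n) (cQ n) (cE₂ n) (cJ4 n) (cΛ₂ n) (cR₂ n) (cQ₂ n) (x₀ n)
          (WE n) (WJ n) (WΛ n) (WR n) (WQ n) (ωgl n) (ωgh n) ((n : ℝ) ^ 8) N μ ν b
            (Sum.inr (Sum.inr (Sum.inr (Sum.inl ((0 : Fin 2), (0 : Fin 2), r, r'))))) w)| ≤ CG r r') :
    ∃ CL : RestIdx → ℝ, ∀ n : ℕ, 2 ≤ n → ∀ [NeZero n], ∀ τ ∈ localFibre,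
      |∑ b ∈ (univ : Finset (Fin 4 → Fin n)).image resSite, ((n : ℝ) ^ 4)⁻¹ *
        fullSum (fun w : Pt => restKS n a (gfrz n a b) (fun v => s n * gfrz n a b v) (cE n) (cΛ n) (cR n) (cK n) (cQ n) (cE₂ n) (cJ4 n) (cΛ₂ n)
          (cR₂ n) (cQ₂ n) (x₀ n) (WE n) (WJ n) (WΛ n) (WR n) (WQ n) (ωgl n) (ωgh n) ((n : ℝ) ^ 8) N μ ν b τ w)| ≤ CL τ := by
  classical
  -- the record's local row at ghost weight `0`: its «L-GBUB» input is the zero row there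
  obtain ⟨CL0, hLoc0⟩ := hLoc_of_prop12' (cE := cE) (cΛ := cΛ) (cR := cR) (cK := cK) (cQ := cQ) (cE₂ := cE₂) (cJ4 := cJ4) (cΛ₂ := cΛ₂) (cR₂ := cR₂)
    (cQ₂ := cQ₂) (x₀ := x₀) (ωgl := ωgl) (ωgh := (0 : ℕ → ℝ)) (WE := WE) (WJ := WJ) (WΛ := WΛ) (WR := WR) (WQ := WQ) (N := N) (μ := μ) (ν := ν)
    (CG := (0 : Fin 2 → Fin 2 → ℝ)) ha h12 h126 hlam hJ hδ₀ hδE hWE hsuppE hkE hθR hδR hδ₀R hδRge hCwR hWR hkR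
    (fun r r' _ n hn _ => (row_gbub_zeroWeight_le (a := a) (N := N) (μ := μ) (ν := ν) (cE := cE) (cΛ := cΛ) (cR := cR) (cK := cK) (cQ := cQ)
      (cE₂ := cE₂) (cJ4 := cJ4) (cΛ₂ := cΛ₂) (cR₂ := cR₂) (cQ₂ := cQ₂) (x₀ := x₀) (ωgl := ωgl) (WE := WE) (WJ := WJ) (WΛ := WΛ) (WR := WR) (WQ := WQ)
      ((0 : Fin 2), (0 : Fin 2), r, r') n hn).trans (le_of_eq (by simp)))
  -- ONE constant per word: the record's, raised by the three displayed ghost constants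
  set S : ℝ := |CG 0 1| + |CG 1 0| + |CG 1 1| with hSdef
  have hS : 0 ≤ S := by positivity
  refine ⟨fun τ => max (CL0 τ) S, fun n hn _ τ hτ => ?_⟩
  have hτ' := (mem_localFibre τ).1 hτ
  obtain ⟨hτ1, hτ2, hτ3⟩ := hτ'
  rcases τ with x | x | q | ⟨i, j, r, r'⟩ | k
  · -- gluon tadpoles: the record's word at any ghost weight
    refine le_trans ?_ (le_max_left _ _)
    simp_rw [restKS_tad_eq_zeroWeight]
    exact hLoc0 n hn (Sum.inl x) hτ
  · -- gluon bubbles: idem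
    refine le_trans ?_ (le_max_left _ _)
    simp_rw [restKS_bub_eq_zeroWeight]
    exact hLoc0 n hn (Sum.inr (Sum.inl x)) hτ
  · -- ghost tadpoles are needle words
    exact absurd (mem_needleFibre'_gtad q) hτ2
  · -- ghost bubbles: `i = j = 0` (`i = 1 ∨ j = 1` is a needle word); the `0000` word is `0`, the other three are «L-GBUB» at the second profile
    have hm := (mem_needleFibre'_gbub (i, j, r, r')).not.1 hτ2
    have hi1 : i ≠ 1 := fun h => hm (Or.inl h)
    have hj1 : j ≠ 1 := fun h => hm (Or.inr h)
    obtain rfl := fin2_eq_zero hi1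
    obtain rfl := fin2_eq_zero hj1
    refine le_trans ?_ (le_max_right _ _)
    by_cases hrr : r = 0 ∧ r' = 0
    · obtain ⟨hr, hr'⟩ := hrr
      subst hr; subst hr'
      exact (row_restKS_gbub_zero_le (a := a) (cE := cE) (cΛ := cΛ) (cR := cR) (cK := cK) (cQ := cQ) (cE₂ := cE₂) (cJ4 := cJ4) (cΛ₂ := cΛ₂)
        (cR₂ := cR₂) (cQ₂ := cQ₂) (x₀ := x₀) (ωgl := ωgl) (ωgh := ωgh) (s := s) (WE := WE) (WJ := WJ) (WΛ := WΛ) (WR := WR) (WQ := WQ) (N := N)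
        (μ := μ) (ν := ν) n hn).trans hS
    · have hw := hGbub r r' hrr n hn
      simp_rw [restKS_gbub_eq]
      refine hw.trans ?_
      have h01 : |CG 0 1| ≤ S := by rw [hSdef]; have := abs_nonneg (CG 1 0); have := abs_nonneg (CG 1 1); linarith
      have h10 : |CG 1 0| ≤ S := by rw [hSdef]; have := abs_nonneg (CG 0 1); have := abs_nonneg (CG 1 1); linarith
      have h11 : |CG 1 1| ≤ S := by rw [hSdef]; have := abs_nonneg (CG 0 1); have := abs_nonneg (CG 1 0); linarith
      fin_cases r <;> fin_cases r'
      · exact absurd ⟨rfl, rfl⟩ hrr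
      · exact (le_abs_self _).trans h01
      · exact (le_abs_self _).trans h10
      · exact (le_abs_self _).trans h11
  · -- the last summand: the corner (`k = 0`, excluded) and the cross word (`k = 1`, the record's at any ghost weight)
    by_cases hk : k = 0
    · subst hk
      exact absurd rfl hτ3
    · have hk1 : k = 1 := by
        fin_cases k
        · exact absurd rfl hk
        · rfl
      subst hk1
      refine le_trans ?_ (le_max_left _ _)
      simp_rw [restKS_crossE_eq_zeroWeight]
      exact hLoc0 n hn (Sum.inr (Sum.inr (Sum.inr (Sum.inr 1)))) hτ

end Summit.QuantumFields.BalabanUV.Beta.D1BFx.LocalGroupRowS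

end
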